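import Mathlib
import Literature.Analysis.FluidPDE.NSLerayStrongLocalExistence
import Literature.Analysis.FluidPDE.SereginSverak2002PressureLowerBoundProofs
import Literature.Analysis.FluidPDE.EulerTimeScaling
import Literature.Analysis.FluidPDE.SwirlMaximumPrinciple
import Summits.NavierStokesRegularity.OSWSelfSimilar.TypeIIInnerLimitMasterCore
import Summits.NavierStokesRegularity.OSWSelfSimilar.TypeIIInnerLimitMasterViscosity
import Summits.NavierStokesRegularity.NavierStokesRegularity.Theorems.CertifiedBlowupCertifiedBlowupAxisymBlowupBlowupSet
import HarnessLib
/-!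
# The Z1 inner-object master theorem on DATUM-LEVEL hypotheses, and (C4)/(E0): the zoom centres accumulate on the
# singular set, on the axis (zone Z1 TEMPLATE §T1.0 (E0), §T1.4-III (C4), (K60); kernel, unconditional, any ν > 0)

HONEST FRAMING (cell ns-blowup GROUP B «PROFILE SEARCH», zone Z1; D-0035/D-0074): part XXXV of the Z1 dictionary. Parts
XXIII–XXXIII carry two STANDING hypotheses of K8 type that are not properties of the datum: «`u` is bounded on every
closed sub-slab `[0, S] × ℝ³`, `S < T⋆`» and «EVERY slice `u t` is axisymmetric». The tree's `CertifiedBlowup` lineage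
(`bounded_before_of_lerayHopf_classical`, `isAxisymmetric_slice_of_lerayHopf_classical`, p-landed in
`CertifiedBlowupAxisymBlowupSwirlPersists`) derives both on `[0, T⋆)` from `HasRapidSpatialDecay (u 0)` and
`IsAxisymmetric (u 0)`; slices outside `[0, T⋆)` are junk values of `u` and are frozen to `0` here (the analytic core,
part XXXIV, never looks outside the slab: every zoom time `tₖ + λₖ²s`, `s < 0`, is eventually in `[0, T⋆)`). So:

* `innerObject_master_of_datum` — THE MASTER THEOREM (part XXXIII's conclusion verbatim, any `ν > 0`) from the CLAY-CLASS
  DATUM HYPOTHESES ONLY: `IsMaximalSmoothSolution ν 0 u p T⋆`, `T⋆ > 0`, `IsLerayHopfOn T⋆ ν 0 (u 0) u`,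
  `HasRapidSpatialDecay (u 0)`, `IsAxisymmetric (u 0)`, `|Γ(0, ·)| ≤ Mₛ`; PLUS the (C4)/(E0) riders: `tₖ → T⋆`; near-max
  points `xₖ` with `(λₖ/ν)‖u(tₖ, xₖ)‖ → 1` and `‖xₖ − cₖ‖ ≤ Dλₖ`; the centres `cₖ` stay in a fixed ball; EVERY cluster point
  of `(cₖ)` is a SINGULAR point at `T⋆` (`¬ IsBoundedNearTop u T⋆ x₀`: `u` unbounded on every backward parabolic
  neighbourhood of `(T⋆, x₀)`) and lies ON THE AXIS (`cylRadius x₀ = 0`, the tree's off-axis regularity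
  `cylRadius_eq_zero_of_not_isBoundedNearTop`, Seregin–Šverák 2009 §3 / CKN); a cluster point exists; and
  `cylRadius cₖ → 0` — IN BOTH CASES of the extraction (in Case B the centres `rₖe₀ + zₖe₂` have `rₖ/λₖ → ∞` but still
  `rₖ → 0`). This is TEMPLATE (E0)'s «blow-up centre `x*(t) = (0, 0, z*(t))` … by CKN every singular point lies on the
  axis» and (C4) as kernel statements about the gauge N-a zoom, for a HYPOTHETICAL singular solution.
* bookkeeping lemmas: `eventually_zoomTime_mem_Ico`, `tendsto_atTop_of_gauge_tendsto_one`,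
  `exists_forall_norm_le_of_eventually`, `mapClusterPt_of_tendsto_norm_sub`, `not_isBoundedNearTop_of_mapClusterPt`.

**Nothing here asserts that a singular solution exists or that (AX-L) holds or fails.** «violates: n/a — dictionary;
(K60) items 'bounded sub-slabs hypothesis' and '(C4)/(E0) centres → axis' discharged»; bears_on LADDER-NS N5/Z1 → N1
linear core / N0⁻. Author: ns-blowup-profile-eng-1 g9, 2026-08-27.
-/

open Real Filter Topology Set MeasureTheory Function Bornology Metric
open scoped ENNReal NNReal
open Literature.Analysis.FluidPDE
open Summit.NavierStokesRegularity.NavierStokesRegularity.Theorems.CertifiedBlowupAxisymBlowup.CompactAmplification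

namespace Summit.NavierStokesRegularity.OSWSelfSimilar
namespace TypeIIModulationDictionary

section Bookkeeping

/-- **Zoom times are eventually inside the slab**: if `tₖ ∈ [T'/2, T')`, `λₖ → 0` and `s ≤ 0`, then
`tₖ + λₖ² s ∈ [0, T')` for all large `k`. [new here — elementary] -/
theorem eventually_zoomTime_mem_Ico {T' : ℝ} {tn lamn : ℕ → ℝ} (htn : ∀ k, T' / 2 ≤ tn k ∧ tn k < T')
    (hlam0 : Tendsto lamn atTop (𝓝 0)) (hT' : 0 < T') {s : ℝ} (hs : s ≤ 0) :
    ∀ᶠ k in atTop, tn k + lamn k ^ 2 * s ∈ Ico 0 T' := by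
  have h1 : Tendsto (fun k => lamn k ^ 2 * s) atTop (𝓝 0) := by
    simpa using (hlam0.pow 2).mul_const s
  have h2 : ∀ᶠ k in atTop, -(T' / 2) < lamn k ^ 2 * s := h1.eventually (lt_mem_nhds (by linarith))
  filter_upwards [h2] with k hk
  have h3 : lamn k ^ 2 * s ≤ 0 := mul_nonpos_of_nonneg_of_nonpos (sq_nonneg _) hs
  exact ⟨by linarith [(htn k).1], by linarith [(htn k).2]⟩

/-- **The gauge normalisation forces blow-up of the near-max values**: `μₖ > 0`, `μₖ → 0`, `μₖ aₖ → 1` imply `aₖ → +∞`.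
[new here — elementary] -/
theorem tendsto_atTop_of_gauge_tendsto_one {μ a : ℕ → ℝ} (hμ : ∀ k, 0 < μ k) (hμ0 : Tendsto μ atTop (𝓝 0))
    (h : Tendsto (fun k => μ k * a k) atTop (𝓝 1)) : Tendsto a atTop atTop := by
  have hinv : Tendsto (fun k => (μ k)⁻¹) atTop atTop :=
    tendsto_inv_nhdsGT_zero.comp (tendsto_nhdsWithin_iff.2 ⟨hμ0, Eventually.of_forall hμ⟩)
  have hhalf : Tendsto (fun k => (1 / 2 : ℝ) * (μ k)⁻¹) atTop atTop := hinv.const_mul_atTop (by norm_num)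
  refine tendsto_atTop_mono' atTop ?_ hhalf
  filter_upwards [h.eventually (lt_mem_nhds (by norm_num : (1 / 2 : ℝ) < 1))] with k hk
  have hμk := hμ k
  calc (1 / 2 : ℝ) * (μ k)⁻¹ ≤ (μ k * a k) * (μ k)⁻¹ := by gcongr
    _ = a k := by field_simp

/-- An eventually bounded sequence of vectors is bounded. [new here — elementary] -/
theorem exists_forall_norm_le_of_eventually {E : Type*} [SeminormedAddCommGroup E] {c : ℕ → E} {R : ℝ}
    (h : ∀ᶠ k in atTop, ‖c k‖ ≤ R) : ∃ R' : ℝ, ∀ k, ‖c k‖ ≤ R' := by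
  obtain ⟨N, hN⟩ := eventually_atTop.1 h
  refine ⟨max R (∑ i ∈ Finset.range N, ‖c i‖), fun k => ?_⟩
  by_cases hk : N ≤ k
  · exact (hN k hk).trans (le_max_left _ _)
  · exact (Finset.single_le_sum (f := fun i => ‖c i‖) (fun i _ => norm_nonneg _)
      (Finset.mem_range.2 (not_le.1 hk))).trans (le_max_right _ _)

/-- Cluster points pass between sequences at vanishing distance. [new here — elementary] -/
theorem mapClusterPt_of_tendsto_norm_sub {E : Type*} [SeminormedAddCommGroup E] {xn cn : ℕ → E} {x₀ : E}
    (h : MapClusterPt x₀ atTop cn) (hd : Tendsto (fun k => ‖xn k - cn k‖) atTop (𝓝 0)) :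
    MapClusterPt x₀ atTop xn := by
  rw [mapClusterPt_iff_frequently] at h ⊢
  intro U hU
  obtain ⟨ε, hε, hball⟩ := Metric.mem_nhds_iff.1 hU
  have hfr := h (ball x₀ (ε / 2)) (ball_mem_nhds _ (half_pos hε))
  have hev : ∀ᶠ k in atTop, ‖xn k - cn k‖ < ε / 2 := hd.eventually (gt_mem_nhds (half_pos hε))
  refine (hfr.and_eventually hev).mono fun k hk => hball ?_
  obtain ⟨hk1, hk2⟩ := hk
  rw [mem_ball, dist_eq_norm] at hk1 ⊢
  calc ‖xn k - x₀‖ = ‖(xn k - cn k) + (cn k - x₀)‖ := by rw [sub_add_sub_cancel]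
    _ ≤ ‖xn k - cn k‖ + ‖cn k - x₀‖ := norm_add_le _ _
    _ < ε := by linarith

/-- **A cluster point of points carrying unbounded values at times `tₖ ↑ T` is a singular point at `T`**: if `tₖ → T`,
`tₖ < T`, `‖u(tₖ, xₖ)‖ → ∞` and `x₀` is a cluster point of `(xₖ)`, then `u` is unbounded on every backward parabolic
neighbourhood `(T − r², T) × B(x₀, r)` — `¬ IsBoundedNearTop u T x₀`. [new here — elementary] -/
theorem not_isBoundedNearTop_of_mapClusterPt {u : ℝ → EuclideanSpace ℝ (Fin 3) → EuclideanSpace ℝ (Fin 3)} {T : ℝ}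
    {tn : ℕ → ℝ} {xn : ℕ → EuclideanSpace ℝ (Fin 3)} {x₀ : EuclideanSpace ℝ (Fin 3)} (htT : Tendsto tn atTop (𝓝 T))
    (hlt : ∀ k, tn k < T) (hblow : Tendsto (fun k => ‖u (tn k) (xn k)‖) atTop atTop)
    (hx₀ : MapClusterPt x₀ atTop xn) : ¬ IsBoundedNearTop u T x₀ := by
  rintro ⟨r, hr, K, hK⟩
  have h1 : ∀ᶠ k in atTop, T - r ^ 2 < tn k := htT.eventually (lt_mem_nhds (by nlinarith))
  have h2 : ∀ᶠ k in atTop, K < ‖u (tn k) (xn k)‖ := hblow.eventually_gt_atTop K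
  have h3 : ∃ᶠ k in atTop, xn k ∈ ball x₀ r := (mapClusterPt_iff_frequently.1 hx₀) _ (ball_mem_nhds _ hr)
  obtain ⟨k, hk3, hk1, hk2⟩ := (h3.and_eventually (h1.and h2)).exists
  exact (not_le.2 hk2) (hK (tn k) ⟨hk1, hlt k⟩ (xn k) hk3)

end Bookkeeping

section Datum

variable {T ν Mₛ : ℝ} {u : ℝ → EuclideanSpace ℝ (Fin 3) → EuclideanSpace ℝ (Fin 3)}
  {p : ℝ → EuclideanSpace ℝ (Fin 3) → ℝ}

/-- **THE Z1 INNER-OBJECT MASTER THEOREM ON DATUM-LEVEL HYPOTHESES, WITH (C4)/(E0) (unconditional; any ν > 0).** Let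
`(u, p)` be a maximal smooth unforced solution at viscosity `ν > 0` with finite lifespan `T⋆ > 0`
(`IsMaximalSmoothSolution ν 0 u p T⋆`), Leray–Hopf on `[0, T⋆)` from its datum, the DATUM rapidly decaying and
axisymmetric, `|Γ(0, ·)| ≤ Mₛ`. Then there are gauge N-a zoom data `tₖ ∈ [T⋆/2, T⋆)` with `tₖ → T⋆`, `λₖ > 0 → 0`,
`(λₖ/ν)‖u‖ ≤ 1` on `[0, tₖ]`, centres `cₖ`, NEAR-MAX POINTS `xₖ` (`(λₖ/ν)‖u(tₖ, xₖ)‖ → 1`, `‖xₖ − cₖ‖ ≤ Dλₖ`), the centres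
BOUNDED, EVERY cluster point `x₀` of `(cₖ)` a SINGULAR POINT at `T⋆` ON THE AXIS (`¬ IsBoundedNearTop u T⋆ x₀`,
`cylRadius x₀ = 0`), a cluster point EXISTS, `cylRadius cₖ → 0`; and ONE subsequence `φ` along which the zoom
`y ↦ (λₖ/ν)u(tₖ + (λₖ²/ν)s, cₖ + λₖy)` converges slice-wise locally uniformly to a KNSS blow-up limit `W` (with the Oseen
identity), the zoomed vorticity converges to `curl W`, and EXACTLY ONE of (α) `W ≡ c`, `‖c‖ = 1`, `c₁ = 0`, zoomed
vorticity `→ 0`; (β) centres on the axis, `W` refutes `AxisymmetricLiouvilleBoundedSwirl` (axisymmetric slices,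
`|Γ_W| ≤ Mₛ/ν`, a non-constant slice) with every (I-5) rider of part XXXIII. [new here — dictionary; unconditional] -/
theorem innerObject_master_of_datum (hν : 0 < ν) (hT : 0 < T) (hmax : IsMaximalSmoothSolution ν 0 u p T)
    (hLH : IsLerayHopfOn T ν 0 (u 0) u) (hdec : HasRapidSpatialDecay (u 0)) (haxi : IsAxisymmetric (u 0))
    (hMₛ : ∀ x, |swirl (u 0) x| ≤ Mₛ) :
    ∃ (tn lamn : ℕ → ℝ) (cn xn : ℕ → EuclideanSpace ℝ (Fin 3)) (φ : ℕ → ℕ)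
      (W : ℝ → EuclideanSpace ℝ (Fin 3) → EuclideanSpace ℝ (Fin 3)),
      (∀ k, T / 2 ≤ tn k ∧ tn k < T) ∧ Tendsto tn atTop (𝓝 T) ∧ (∀ k, 0 < lamn k) ∧ Tendsto lamn atTop (𝓝 0) ∧
      (∀ k, ∀ t ∈ Icc 0 (tn k), ∀ x, lamn k / ν * ‖u t x‖ ≤ 1) ∧
      Tendsto (fun k => lamn k / ν * ‖u (tn k) (xn k)‖) atTop (𝓝 1) ∧
      (∃ D : ℝ, ∀ k, ‖xn k - cn k‖ ≤ D * lamn k) ∧ (∃ R : ℝ, ∀ k, ‖cn k‖ ≤ R) ∧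
      (∀ x₀ : EuclideanSpace ℝ (Fin 3), MapClusterPt x₀ atTop cn → ¬ IsBoundedNearTop u T x₀ ∧ cylRadius x₀ = 0) ∧
      (∃ x₀ : EuclideanSpace ℝ (Fin 3), MapClusterPt x₀ atTop cn) ∧
      Tendsto (fun k => cylRadius (cn k)) atTop (𝓝 0) ∧
      StrictMono φ ∧ IsKNSSBlowupLimit W ∧
      (∀ s < 0, TendstoLocallyUniformly
        (fun k => ((lamn (φ k) / ν) • stPull (lamn (φ k) ^ 2 / ν) (lamn (φ k)) (tn (φ k)) (cn (φ k)) u) s)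
          (W s) atTop) ∧
      (∀ s t : ℝ, s < t → t < 0 → ∀ x,
        W t x = Literature.Analysis.UnboundedOperators.heatExtension (W s) (t - s) x - oseenDuhamel 1 s W W t x) ∧
      (∀ s < 0, ∀ y : EuclideanSpace ℝ (Fin 3), Tendsto (fun j => (lamn (φ j) ^ 2 / ν) •
        curl (u (tn (φ j) + lamn (φ j) ^ 2 / ν * s)) (cn (φ j) + lamn (φ j) • y)) atTop (𝓝 (curl (W s) y))) ∧
      (((∃ c : EuclideanSpace ℝ (Fin 3), ‖c‖ = 1 ∧ c 1 = 0 ∧ ∀ s < 0, ∀ y : EuclideanSpace ℝ (Fin 3), W s y = c) ∧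
          ∀ s < 0, ∀ y : EuclideanSpace ℝ (Fin 3), Tendsto (fun j => (lamn (φ j) ^ 2 / ν) •
            curl (u (tn (φ j) + lamn (φ j) ^ 2 / ν * s)) (cn (φ j) + lamn (φ j) • y)) atTop (𝓝 0)) ∨
        ((∀ k, cn k 0 = 0 ∧ cn k 1 = 0) ∧
          ¬ Summit.NavierStokesRegularity.NavierStokesRegularity.AxisymmetricLiouvilleBoundedSwirl ∧
          (∀ s < 0, IsAxisymmetric (W s)) ∧ (∀ s < 0, ∀ y : EuclideanSpace ℝ (Fin 3), |swirl (W s) y| ≤ Mₛ / ν) ∧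
          (∃ s < 0, ∃ x : EuclideanSpace ℝ (Fin 3), W s x ≠ W s 0) ∧
          (∃ s < 0, ∃ y : EuclideanSpace ℝ (Fin 3), curl (W s) y ≠ 0) ∧
          (∃ s < 0, ∃ y : EuclideanSpace ℝ (Fin 3), swirl (W s) y ≠ 0 ∧
            Tendsto (fun k => ν⁻¹ * swirl (u (tn (φ k) + lamn (φ k) ^ 2 / ν * s)) (cn (φ k) + lamn (φ k) • y)) atTop
              (𝓝 (swirl (W s) y))) ∧
          (∀ C : ℝ, ∃ s < 0, ∃ x : EuclideanSpace ℝ (Fin 3), C < cylRadius x * ‖poloidalPart (W s) x‖) ∧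
          (∀ c C : ℝ, ∃ s < 0, ∃ x : EuclideanSpace ℝ (Fin 3), C < cylRadius x * ‖poloidalPart (W s) x - c • eZ‖) ∧
          (∀ q : ℝ≥0∞, 1 ≤ q → q < ⊤ → ∀ K : ℝ≥0, ∃ s < 0, (K : ℝ≥0∞) < eLpNorm (swirl (W s)) q volume) ∧
          (∃ ε : ℝ, 0 < ε ∧ ∀ R : ℝ, ∃ s < 0, ∃ x : EuclideanSpace ℝ (Fin 3),
            R ≤ cylRadius x ∧ ε < |swirl (W s) x|) ∧
          ∃ ε₀ ∈ Set.Ioo (0 : ℝ) 1, ∀ L R₀ : ℝ, ∃ s < 0, ∃ x : EuclideanSpace ℝ (Fin 3),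
            R₀ ≤ cylRadius x ∧ ε₀ * L ^ 2 / cylRadius x < |swirl (W s) x ^ 2 - L ^ 2|)) := by
  -- ### Step 1: unit viscosity (as in parts XXVII/XXXIII)
  set v : ℝ → EuclideanSpace ℝ (Fin 3) → EuclideanSpace ℝ (Fin 3) := timeRescale ν⁻¹ ν⁻¹ u with hv
  have hνT : 0 < ν * T := mul_pos hν hT
  have hmax' : IsMaximalSmoothSolution 1 0 v (timeRescale ν⁻¹ (ν⁻¹ ^ 2) p) (ν * T) := hmax.toUnitViscosity hν
  have hv0 : v 0 = ν⁻¹ • u 0 := by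
    funext x
    simp [hv, timeRescale_apply]
  have hLH' : IsLerayHopfOn (ν * T) 1 0 (v 0) v := by
    have h := hLH.viscosityRescale (inv_pos.2 hν)
    rw [inv_mul_cancel₀ hν.ne', timeRescale_zero_force, div_inv_eq_mul, mul_comm T ν] at h
    rwa [hv0]
  have hdec' : HasRapidSpatialDecay (v 0) := by
    rw [hv0]
    exact SereginSverak2002_pressureOneSidedBound.hasRapidSpatialDecay_const_smul
      (hmax.1.contDiff_velocity ⟨le_rfl, hT⟩) hdec ν⁻¹
  have haxi' : IsAxisymmetric (v 0) := by
    rw [hv0]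
    exact haxi.const_smul ν⁻¹
  have hMₛ' : ∀ x, |swirl (v 0) x| ≤ Mₛ / ν := fun x => by
    have h := swirl_timeRescale_zero (u := u) hMₛ ν⁻¹ ν⁻¹ x
    rwa [abs_of_pos (inv_pos.2 hν), inv_mul_eq_div] at h
  -- ### Step 2: K8's standing hypotheses for `v` ON THE SLAB, from the datum (CertifiedBlowup lineage at ν = 1)
  have hbddv : ∀ S < ν * T, ∃ N : ℝ, 0 < N ∧ ∀ t ∈ Icc 0 S, ∀ x, ‖v t x‖ ≤ N := fun S hS => by
    obtain ⟨M, hM⟩ := bounded_before_of_lerayHopf_classical one_pos hmax'.1 hLH' hdec' haxi' S hS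
    exact ⟨max M 1, lt_max_of_lt_right one_pos, fun t ht x => (hM t ht x).trans (le_max_left _ _)⟩
  have haxiv : ∀ t ∈ Ico 0 (ν * T), IsAxisymmetric (v t) :=
    isAxisymmetric_slice_of_lerayHopf_classical one_pos hmax'.1 hLH' hdec' haxi'
  have hEv := energyBound_of_lerayHopf hLH'
  have hunbv := unbounded_of_not_hasSmoothExtensionPast hνT hmax'.1 hLH' hmax'.2
  -- ### Step 3: freeze `v` to `0` off the slab `[0, νT)` — the slices out there are junk values and the core never reads them
  set w : ℝ → EuclideanSpace ℝ (Fin 3) → EuclideanSpace ℝ (Fin 3) :=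
    fun t => if 0 ≤ t ∧ t < ν * T then v t else 0 with hw
  have hw_eq : ∀ t ∈ Ico 0 (ν * T), w t = v t := fun t ht => by
    simp only [hw, if_pos (show 0 ≤ t ∧ t < ν * T from ⟨ht.1, ht.2⟩)]
  have h0I : (0 : ℝ) ∈ Ico 0 (ν * T) := ⟨le_rfl, hνT⟩
  have hclw : IsClassicalNSSolutionOn (Ico 0 (ν * T)) 1 0 w (timeRescale ν⁻¹ (ν⁻¹ ^ 2) p) :=
    hmax'.1.congr_velocity hw_eq
  have haxiw : ∀ t, IsAxisymmetric (w t) := fun t => by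
    by_cases ht : 0 ≤ t ∧ t < ν * T
    · rw [hw_eq t ht]
      exact haxiv t ht
    · have h0 : w t = 0 := by simp only [hw, if_neg ht]
      rw [h0]
      exact isAxisymmetric_zero
  have hEw : ∀ S < ν * T, ∃ C : ℝ≥0∞, C < ⊤ ∧ ∀ t ∈ Icc 0 S, ∫⁻ x, ‖w t x‖ₑ ^ 2 ≤ C := fun S hS => by
    obtain ⟨C, hC, hb⟩ := hEv S hS
    exact ⟨C, hC, fun t ht => by rw [hw_eq t ⟨ht.1, lt_of_le_of_lt ht.2 hS⟩]; exact hb t ht⟩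
  have hbddw : ∀ S < ν * T, ∃ N : ℝ, 0 < N ∧ ∀ t ∈ Icc 0 S, ∀ x, ‖w t x‖ ≤ N := fun S hS => by
    obtain ⟨N, hN, hb⟩ := hbddv S hS
    exact ⟨N, hN, fun t ht x => by rw [hw_eq t ⟨ht.1, lt_of_le_of_lt ht.2 hS⟩]; exact hb t ht x⟩
  have hMₛw : ∀ x, |swirl (w 0) x| ≤ Mₛ / ν := fun x => by
    rw [hw_eq 0 h0I]
    exact hMₛ' x
  have hunbw : ∀ N : ℝ, ∃ t ∈ Ico 0 (ν * T), ∃ x : EuclideanSpace ℝ (Fin 3), N < ‖w t x‖ := fun N => by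
    obtain ⟨t, ht, x, hx⟩ := hunbv N
    exact ⟨t, ht, x, by rwa [hw_eq t ht]⟩
  -- ### Step 4: the analytic core (part XXXIV) on `w`
  obtain ⟨tn', lamn, cn, xn, φ, W, htn', htT', hlam, hlam0, hgauge', hnear', hdist, hφ, hW, hconv', hmild, hcurl',
    halt'⟩ := innerObject_master_core hνT hclw haxiw hEw hbddw hMₛw hunbw
  -- ### Step 5: read back on `v` (the core never left the slab)
  have htnI : ∀ k, tn' k ∈ Ico 0 (ν * T) := fun k => ⟨le_trans (by positivity) (htn' k).1, (htn' k).2⟩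
  have hzt : ∀ s : ℝ, s ≤ 0 → ∀ᶠ k in atTop, tn' (φ k) + lamn (φ k) ^ 2 * s ∈ Ico 0 (ν * T) := fun s hs =>
    eventually_zoomTime_mem_Ico (tn := tn' ∘ φ) (lamn := lamn ∘ φ) (fun k => htn' (φ k))
      (hlam0.comp hφ.tendsto_atTop) hνT hs
  have hgaugev : ∀ k, ∀ t ∈ Icc 0 (tn' k), ∀ x, lamn k * ‖v t x‖ ≤ 1 := fun k t ht x => by
    rw [← hw_eq t ⟨ht.1, lt_of_le_of_lt ht.2 (htn' k).2⟩]
    exact hgauge' k t ht x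
  have hnearv : Tendsto (fun k => lamn k * ‖v (tn' k) (xn k)‖) atTop (𝓝 1) :=
    hnear'.congr fun k => by rw [hw_eq _ (htnI k)]
  have hconvv : ∀ s < 0, TendstoLocallyUniformly
      (fun k => (lamn (φ k) • stPull (lamn (φ k) ^ 2) (lamn (φ k)) (tn' (φ k)) (cn (φ k)) v) s) (W s) atTop :=
    fun s hs => (hconv' s hs).congr_inseparable ((hzt s hs.le).mono fun k hk y => Inseparable.of_eq (by
      simp only [Pi.smul_apply, stPull_apply]
      rw [hw_eq _ hk]))
  have hcurlv : ∀ s < 0, ∀ y : EuclideanSpace ℝ (Fin 3), Tendsto (fun j => lamn (φ j) ^ 2 •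
      curl (v (tn' (φ j) + lamn (φ j) ^ 2 * s)) (cn (φ j) + lamn (φ j) • y)) atTop (𝓝 (curl (W s) y)) :=
    fun s hs y => (hcurl' s hs y).congr' ((hzt s hs.le).mono fun j hj => by rw [hw_eq _ hj])
  -- ### Step 6: read back on `u` (dictionary of times `tₖ = ν⁻¹tₖ'`, as in part XXXIII)
  have htime : ∀ k (s : ℝ), ν⁻¹ * (tn' (φ k) + lamn (φ k) ^ 2 * s) =
      ν⁻¹ * tn' (φ k) + lamn (φ k) ^ 2 / ν * s := fun k s => by ring
  have hcurl : ∀ s < 0, ∀ y : EuclideanSpace ℝ (Fin 3), Tendsto (fun j => (lamn (φ j) ^ 2 / ν) •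
      curl (u (ν⁻¹ * tn' (φ j) + lamn (φ j) ^ 2 / ν * s)) (cn (φ j) + lamn (φ j) • y)) atTop (𝓝 (curl (W s) y)) := by
    intro s hs y
    refine (hcurlv s hs y).congr fun j => ?_
    rw [hv, curl_timeRescale_slice, smul_smul, htime, div_eq_mul_inv, mul_comm (lamn (φ j) ^ 2) ν⁻¹]
  set tn : ℕ → ℝ := fun k => ν⁻¹ * tn' k with htn_def
  have htn : ∀ k, T / 2 ≤ tn k ∧ tn k < T := fun k => by
    refine ⟨?_, ?_⟩
    · have h := (htn' k).1
      simp only [htn_def]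
      rw [le_inv_mul_iff₀' hν]; linarith
    · have h := (htn' k).2
      simp only [htn_def]
      rw [inv_mul_lt_iff₀ hν]; linarith [mul_comm ν T]
  have htT : Tendsto tn atTop (𝓝 T) := by
    have h := htT'.const_mul ν⁻¹
    rwa [← mul_assoc, inv_mul_cancel₀ hν.ne', one_mul] at h
  have hgauge : ∀ k, ∀ t ∈ Icc 0 (tn k), ∀ x, lamn k / ν * ‖u t x‖ ≤ 1 := fun k t ht x => by
    have hνt : ν * t ∈ Icc 0 (tn' k) := by
      refine ⟨mul_nonneg hν.le ht.1, ?_⟩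
      have := ht.2
      simp only [htn_def] at this
      rw [le_inv_mul_iff₀' hν] at this
      linarith [mul_comm ν t]
    have h := hgaugev k (ν * t) hνt x
    rw [hv, timeRescale_apply, ← mul_assoc, inv_mul_cancel₀ hν.ne', one_mul, norm_smul, Real.norm_eq_abs,
      abs_of_pos (inv_pos.2 hν)] at h
    calc lamn k / ν * ‖u t x‖ = lamn k * (ν⁻¹ * ‖u t x‖) := by ring
      _ ≤ 1 := h
  have hnear : Tendsto (fun k => lamn k / ν * ‖u (tn k) (xn k)‖) atTop (𝓝 1) := by
    refine hnearv.congr fun k => ?_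
    rw [hv, timeRescale_apply, norm_smul, Real.norm_eq_abs, abs_of_pos (inv_pos.2 hν)]
    simp only [htn_def]
    ring
  -- ### Step 7: (C4)/(E0) — the centres accumulate on the singular set, on the axis
  have hblow : Tendsto (fun k => ‖u (tn k) (xn k)‖) atTop atTop :=
    tendsto_atTop_of_gauge_tendsto_one (μ := fun k => lamn k / ν) (fun k => div_pos (hlam k) hν)
      (by simpa using hlam0.div_const ν) hnear
  obtain ⟨R, r, K, hr, hK⟩ := axisymmetricL3_boundedNearTop_infinity
    (axisymmetricL3Hyp_of_lerayHopf_classical hν hT hmax.1 hLH hdec haxi)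
  have hxR : ∀ᶠ k in atTop, ‖xn k‖ < R := by
    have h1 : ∀ᶠ k in atTop, T - r ^ 2 < tn k := htT.eventually (lt_mem_nhds (by nlinarith))
    have h2 : ∀ᶠ k in atTop, K < ‖u (tn k) (xn k)‖ := hblow.eventually_gt_atTop K
    filter_upwards [h1, h2] with k hk1 hk2
    by_contra hle
    exact (not_le.2 hk2) (hK (tn k) ⟨hk1, (htn k).2⟩ (xn k) (not_lt.1 hle))
  obtain ⟨D, hD⟩ := hdist
  have hsub0 : Tendsto (fun k => ‖xn k - cn k‖) atTop (𝓝 0) :=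
    squeeze_zero (fun k => norm_nonneg _) hD (by simpa using hlam0.const_mul D)
  have hcn_ev : ∀ᶠ k in atTop, ‖cn k‖ ≤ R + 1 := by
    have h3 : ∀ᶠ k in atTop, ‖xn k - cn k‖ < 1 := hsub0.eventually (gt_mem_nhds one_pos)
    filter_upwards [hxR, h3] with k hk hk3
    calc ‖cn k‖ = ‖xn k - (xn k - cn k)‖ := by rw [sub_sub_cancel]
      _ ≤ ‖xn k‖ + ‖xn k - cn k‖ := norm_sub_le _ _
      _ ≤ R + 1 := by linarith
  obtain ⟨R', hR'⟩ := exists_forall_norm_le_of_eventually hcn_ev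
  have hclus : ∀ x₀ : EuclideanSpace ℝ (Fin 3), MapClusterPt x₀ atTop cn →
      ¬ IsBoundedNearTop u T x₀ ∧ cylRadius x₀ = 0 := fun x₀ hx₀ => by
    have hnb := not_isBoundedNearTop_of_mapClusterPt htT (fun k => (htn k).2) hblow
      (mapClusterPt_of_tendsto_norm_sub hx₀ hsub0)
    exact ⟨hnb, cylRadius_eq_zero_of_not_isBoundedNearTop hν hT hmax.1 hLH hdec haxi hnb⟩
  have hmem : ∀ k, cn k ∈ closedBall (0 : EuclideanSpace ℝ (Fin 3)) R' := fun k =>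
    mem_closedBall_zero_iff.2 (hR' k)
  have hex : ∃ x₀ : EuclideanSpace ℝ (Fin 3), MapClusterPt x₀ atTop cn := by
    obtain ⟨a, -, ψ, hψ, hlim⟩ := tendsto_subseq_of_bounded (isBounded_closedBall (x := (0 : EuclideanSpace ℝ (Fin 3)))
      (r := R')) (x := cn) hmem
    exact ⟨a, (hlim.mapClusterPt).of_comp hψ.tendsto_atTop⟩
  have hcyl : Tendsto (fun k => cylRadius (cn k)) atTop (𝓝 0) := by
    refine tendsto_of_subseq_tendsto fun ns hns => ?_
    obtain ⟨a, -, ms, hms, hlim⟩ := tendsto_subseq_of_bounded (isBounded_closedBall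
      (x := (0 : EuclideanSpace ℝ (Fin 3))) (r := R')) (x := cn ∘ ns) fun k => hmem (ns k)
    have ha : MapClusterPt a atTop cn := (hlim.mapClusterPt).of_comp (hns.comp hms.tendsto_atTop)
    refine ⟨ms, ?_⟩
    have h := (continuous_cylRadius.tendsto a).comp hlim
    rw [(hclus a ha).2] at h
    exact h
  -- ### Step 8: assemble
  refine ⟨tn, lamn, cn, xn, φ, W, htn, htT, hlam, hlam0, hgauge, hnear, ⟨D, hD⟩, ⟨R', hR'⟩, hclus, hex, hcyl, hφ, hW,
    fun s hs => ?_, hmild, hcurl, ?_⟩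
  · refine (hconvv s hs).congr fun k => ?_
    rw [hv, zoom_timeRescale]
    intro x
    rfl
  · rcases halt' with ⟨hc, hzero⟩ | ⟨hax0, hnot, hax, hsw, hnc, hcurlne, ⟨s, hs, y, hy, hswirl⟩, hrest⟩
    · refine Or.inl ⟨hc, fun s hs y => ?_⟩
      refine ((hzero s hs y).congr' ((hzt s hs.le).mono fun j hj => by rw [hw_eq _ hj])).congr fun j => ?_
      rw [hv, curl_timeRescale_slice, smul_smul, htime, div_eq_mul_inv, mul_comm (lamn (φ j) ^ 2) ν⁻¹]
    · refine Or.inr ⟨hax0, hnot, hax, hsw, hnc, hcurlne, ⟨s, hs, y, hy, ?_⟩, hrest⟩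
      refine (hswirl.congr' ((hzt s hs.le).mono fun k hk => by rw [hw_eq _ hk])).congr fun k => ?_
      rw [hv, swirl_timeRescale_slice, htime]

end Datum

end TypeIIModulationDictionary
end Summit.NavierStokesRegularity.OSWSelfSimilar
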